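import Summits.KontsevichZagierPeriods.KontsevichZagierPeriods.Theorems.IsogenyCertificatesXMapKernelCellsUnconditional

/-!
# Stub-ideation sketch (ideator 2, FAMILY 2 — RESHAPE) for `stub_reductionToRealPeriodSector` = K
of crux `XMapKernel` (stmt-KontsevichZagierPeriods-10663), line `isogeny-orbit-collapse`.

Every RESHAPE of K typed here collapses to the summit by a LANDED theorem; the helper lemmas H1–H4 are
the (one-cycle, transcendence-free) glue that certifies each collapse. Nothing here is proposed for
`Theorems/` except as noted in STUB-IDEAS-stub_reductionToRealPeriodSector-2.md.
-/

noncomputable section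

set_option linter.dupNamespace false

namespace Summit.KontsevichZagierPeriods.KontsevichZagierPeriods.Cruxes.XMapKernel.StubIdeasReduction2

open Literature.NumberTheory.Transcendental
open Summit.KontsevichZagierPeriods.KontsevichZagierPeriods.Theses.IsogenyCertificates
open Summit.KontsevichZagierPeriods.XMapKernel.Negative
open Summit.KontsevichZagierPeriods.IsogenyCertificates

/-- The real-period sector: the generator set of the stub, verbatim. -/
def RP : Set KZ.FormalRep :=
  {d : KZ.FormalRep | ∃ (A B : ℤ) (a : ℚ) (r : KZ.IntegralRep 1), 4 * A ^ 3 + 27 * B ^ 2 ≠ 0 ∧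
    r.domain = {x | 0 < x 0 ^ 3 + (A : ℝ) * x 0 + (B : ℝ)} ∧
    Set.EqOn r.integrand (fun x => (a : ℝ) / Real.sqrt (x 0 ^ 3 + (A : ℝ) * x 0 + (B : ℝ))) r.domain ∧
    d = KZ.of r}

/-- The stub K. -/
def K : Prop :=
  ∀ c : KZ.FormalRep, KZ.eval c = 0 → ∃ c' ∈ AddSubgroup.closure RP, c - c' ∈ AddSubgroup.closure gens

/-- Sanity: `K` is syntactically the registered stub signature. -/
example : K ↔ (∀ c : Literature.NumberTheory.Transcendental.KZ.FormalRep, Literature.NumberTheory.Transcendental.KZ.eval c = 0 → ∃ c' ∈ AddSubgroup.closure {d : Literature.NumberTheory.Transcendental.KZ.FormalRep | ∃ (A B : ℤ) (a : ℚ) (r : Literature.NumberTheory.Transcendental.KZ.IntegralRep 1), 4 * A ^ 3 + 27 * B ^ 2 ≠ 0 ∧ r.domain = {x | 0 < x 0 ^ 3 + (A : ℝ) * x 0 + (B : ℝ)} ∧ Set.EqOn r.integrand (fun x => (a : ℝ) / Real.sqrt (x 0 ^ 3 + (A : ℝ) * x 0 + (B : ℝ))) r.domain ∧ d = Literature.NumberTheory.Transcendental.KZ.of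 r}, c - c' ∈ AddSubgroup.closure Summit.KontsevichZagierPeriods.XMapKernel.Negative.gens) :=
  Iff.rfl

/-! ## The quick refutation of ANY "one-cycle helpers ⇒ K" plan: both probes close by `exact`. -/

/-- PROBE →: K proves the summit (landed, unconditional, p119755). -/
theorem probe_K_to_summit : K → _root_.KontsevichZagierPeriods :=
  XMapKernelCells.reductionToRealPeriodSector_iff_summit_holds.mp

/-- PROBE ←: the summit proves K. -/
theorem probe_summit_to_K : _root_.KontsevichZagierPeriods → K :=
  XMapKernelCells.reductionToRealPeriodSector_iff_summit_holds.mpr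

/-! ## RESHAPE 1 — split into regimes (restrict the SOURCE `c` to a sector `S`) -/

/-- K restricted to kernel elements lying in the regime `S` (dump sector still RP). -/
def KOn (S : AddSubgroup KZ.FormalRep) : Prop :=
  ∀ c ∈ S, KZ.eval c = 0 → ∃ c' ∈ AddSubgroup.closure RP, c - c' ∈ AddSubgroup.closure gens

/-- The cell of `S` (= `StrategistSketch.CellKernel S`): kernel elements of `S` are move-accessible. -/
def CellKernel (S : AddSubgroup KZ.FormalRep) : Prop :=
  ∀ c ∈ S, KZ.eval c = 0 → c ∈ AddSubgroup.closure gens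

/-- The full regime is the stub. -/
theorem kOn_top_iff : KOn ⊤ ↔ K :=
  ⟨fun h c hc => h c trivial hc, fun h c _ hc => h c hc⟩

/-- **H1 (dump inertness).** Because the real-period CELL is landed (`realPeriodCellKernel_holds`), K on ANY
regime `S` is exactly the cell of `S`: the witness `c'` can always be taken `0`. -/
theorem kOn_iff_cellKernel (S : AddSubgroup KZ.FormalRep) : KOn S ↔ CellKernel S := by
  constructor
  · intro h c hcS hc
    obtain ⟨c', hc', hcc'⟩ := h c hcS hc
    have hdiff : KZ.eval (c - c') = 0 := AddMonoidHom.mem_ker.1 (closure_gens_le_ker_eval hcc')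
    have hc'0 : KZ.eval c' = 0 := by
      rw [map_sub, hc, zero_sub, neg_eq_zero] at hdiff
      exact hdiff
    have hc'mem : c' ∈ AddSubgroup.closure gens := XMapKernelCells.realPeriodCellKernel_holds c' hc' hc'0
    have hsplit : c = (c - c') + c' := by abel
    rw [hsplit]
    exact add_mem hcc' hc'mem
  · intro h c hcS hc
    exact ⟨0, zero_mem _, by simpa using h c hcS hc⟩

/-- **H2 (the join step of a regime split).** Gluing two regimes is exactly the cross-sector coincidence
statement: every vanishing sum of an `S₁`-value and an `S₂`-value is move-accessible. -/
theorem cellKernel_sup_iff (S₁ S₂ : AddSubgroup KZ.FormalRep) :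
    CellKernel (S₁ ⊔ S₂) ↔
      ∀ c₁ ∈ S₁, ∀ c₂ ∈ S₂, KZ.eval c₁ + KZ.eval c₂ = 0 → c₁ + c₂ ∈ AddSubgroup.closure gens := by
  constructor
  · intro h c₁ h1 c₂ h2 hsum
    exact h (c₁ + c₂) (AddSubgroup.add_mem_sup h1 h2) (by rw [map_add]; exact hsum)
  · intro h c hc hc0
    obtain ⟨c₁, h1, c₂, h2, rfl⟩ := AddSubgroup.mem_sup.1 hc
    exact h c₁ h1 c₂ h2 (by rw [← map_add]; exact hc0)

/-- **H3 (exhaustion).** Along ANY exhaustion of `FormalRep` by regimes, K is the conjunction of ALL the cells —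
an infinite conjunction; no finite cut closes it (the tail regime's cell is K again, H1 with `S = ⊤`). -/
theorem k_iff_forall_cellKernel {ι : Type*} (S : ι → AddSubgroup KZ.FormalRep) (hS : ∀ c, ∃ i, c ∈ S i) :
    K ↔ ∀ i, CellKernel (S i) := by
  constructor
  · intro h i
    rw [← kOn_iff_cellKernel]
    exact fun c _ hc => h c hc
  · intro h c hc
    obtain ⟨i, hi⟩ := hS c
    exact (kOn_iff_cellKernel (S i)).2 (h i) c hi hc

/-! ## RESHAPE 2 — change the quantifier (∀c ∃c' ↦ the uniform witness c' = 0) -/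

/-- **H4.** K is the kernel conjecture for the enlarged move group verbatim: the `∃ c'` is spurious. -/
theorem k_iff_cellKernel_top : K ↔ ∀ c : KZ.FormalRep, KZ.eval c = 0 → c ∈ AddSubgroup.closure gens := by
  rw [← kOn_top_iff, kOn_iff_cellKernel]
  exact ⟨fun h c hc => h c trivial hc, fun h c _ hc => h c hc⟩

/-- … and with `closure gens = KZ.relations` landed, K is `KZKernelConjecture`-shaped over `KZ.relations`. -/
theorem k_iff_ker_le_relations : K ↔ ∀ c : KZ.FormalRep, KZ.eval c = 0 → c ∈ KZ.relations := by
  rw [k_iff_cellKernel_top, XMapKernelIffSummit.closure_gens_eq_relations_holds]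

/-! ## RESHAPE 3 — weaken-and-bootstrap (a bigger dump sector `D ⊇ closure RP`) -/

/-- K with dump sector `D` (= `StrategistSketch.ReducesTo D`). -/
def KDump (D : AddSubgroup KZ.FormalRep) : Prop :=
  ∀ c : KZ.FormalRep, KZ.eval c = 0 → ∃ c' ∈ D, c - c' ∈ AddSubgroup.closure gens

/-- The weakening is genuine as an implication … -/
theorem kDump_of_k (D : AddSubgroup KZ.FormalRep) (hD : AddSubgroup.closure RP ≤ D) : K → KDump D :=
  fun h c hc => let ⟨c', hc', hcc'⟩ := h c hc; ⟨c', hD hc', hcc'⟩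

/-- … but the bootstrap debt `KDump D → K` is exactly the cell of `D`, and paying it returns the summit
(`reduction_iff_summit_of_cell`, p116992): no loss is ever removed for free. -/
theorem kDump_iff_summit_of_cell (D : AddSubgroup KZ.FormalRep) (hC : CellKernel D) :
    KDump D ↔ _root_.KontsevichZagierPeriods :=
  XMapKernelIffSummit.reduction_iff_summit_of_cell D hC

/-! ## RESHAPE 5 — change the induction variable to the number of terms (two-term normal form) -/

/-- K in the printed two-representation form of Conjecture 1 (rational data): literally the summit. -/
theorem k_iff_twoRep : K ↔ ∀ ⦃n m : ℕ⦄ (r : KZ.IntegralRep n) (r' : KZ.IntegralRep m),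
    r.IsRational → r'.IsRational → r.value = r'.value → KZ.Equivalent r r' :=
  XMapKernelCells.reductionToRealPeriodSector_iff_summit_holds.trans KontsevichZagierPeriods_iff

end Summit.KontsevichZagierPeriods.KontsevichZagierPeriods.Cruxes.XMapKernel.StubIdeasReduction2

end
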